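import Summits.ResolutionOfSingularities.ResolutionOfSingularities.Theorems.HomologicalConductorNoZenoDim2Exhaustion
import HarnessLib

/-!
# Crux `NoZenoR` / `NoZeno` (stmt-ResolutionOfSingularities-19943 / -16483), β-front structure:
# PARASITE VALUATION RINGS AND SINGULAR THREADS (I) — the exhaustion criterion

Route `ResolutionOfSingularities/HomologicalConductor`.  OURS (cell res-hironaka: ideator
res-L0-w44-idea-1, round 6, `Sketch-idea-1-r6.lean` sha16 `6ae3bce5c33cc7eb`; ported to the tree by
res-L0-w44-stub-2 per CHAIN W4.4 v10 §2 / note 40).  Nothing here is a statement of the manuscript under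
review; AI analysis, weaker than expert review.

The β-stubs `stub_kernelRankOneHighExh / …Nex / stub_kernelCompositeHighDim` of the lead's skeleton
(v21) concern the canonical normalised `ca`-tower `T_m = tower O A m` (vocabulary of
`…Theorems.HomologicalConductorNoZenoBirthDefs`: `tower / ca / loc / nrm`) along a valuation ring `O`
of `K/k` in transcendence degree `≥ 3`.  This file (part I of three) isolates the EXHAUSTIVE regime:

* `Exhausts O A` (`⋃ T_m = O`), `RankOne O`, and `Parasite O A W` — a valuation ring `W ≠ O, K`
  containing every stage (a point of the Zariski–Riemann space of `K` other than `O` lying over the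
  whole tower).
* T1 `not_exhausts_of_parasite` — rank one + a parasite ⟹ the stages do NOT exhaust `O`.
* T2 `exists_parasite_of_not_exhausts` — conversely non-exhaustion produces a parasite (normal stages +
  Chevalley, Mathlib `Subring.exists_le_valuationSubring_of_isIntegrallyClosedIn`).
* T2′ `exhausts_iff_forall_not_parasite` — **EXHAUSTION CRITERION**: under rank one,
  `⋃ T_m = O ⟺ the tower has no parasite`.
* `SingularThread O A` — a chain of local subrings `D_m ⊇ T_m`, each dominated by the next, in which
  the centre `ca (T_m)` consists of non-units for every `m` while some element of positive `O`-value is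
  a unit; T3 `exists_parasite_of_singularThread` (the union of the `D_m` is local; any valuation ring
  dominating it is a parasite); T4 `not_exhausts_of_singularThread`, `not_singularThread_of_exhausts`.
* Statements used by parts II/III: `SingularPrimeThread`, `PrimeThreadLocalises` (proved in part II,
  `…ParasiteLocPrime`), `EventuallyExceptionalSing`, `ThreadlessOfExhausts` (proved in part III,
  `…ParasiteThreadless`); L1 `ca_subset_comap_of_persistenceRadical`; C1
  `stubExh_parasiteFree_threadless` (over the literal binders of `stub_kernelRankOneHighExh`).
* Objects of parts II/III, defined here so that those parts are pure-proof files: `locPrime T P hP`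
  (the local ring `T_P` of a stage at a prime, realised inside `K` as fractions `a * b⁻¹`, `b ∉ P`),
  `NumInP` (its non-units), `caIdeal O A m = ca(T_m)·T_m`, `singRad O A m = √(ca(T_m)·T_m)`.

References (for the two Chevalley-type extension lemmas used from Mathlib / the tree): O. Zariski,
P. Samuel, *Commutative Algebra* II (1960), Ch. VI §4 [`ZariskiSamuel1960`]; S. Abhyankar, Amer. J.
Math. 78 (1956) [`Abhyankar1956Valuations`].  No named facts, no new axioms, no sorry.
-/

noncomputable section

-- single-problem summit: the doubled namespace component `ResolutionOfSingularities` is forced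
set_option linter.dupNamespace false

namespace Summit.ResolutionOfSingularities.ResolutionOfSingularities.Theorems.NoZeno.SandwichCluster.Parasite

open Summit.ResolutionOfSingularities.ResolutionOfSingularities.Theorems.NoZeno.Birth
open Summit.ResolutionOfSingularities.ResolutionOfSingularities.Theorems
open Literature.AlgebraicGeometry.Resolution IsLocalRing Polynomial

variable {k K : Type} [Field k] [Field K] [Algebra k K]

/-! ## Exhaustion, rank one, parasites -/

/-- The stages exhaust `O` (`⋃ T_m = O`): hypothesis `hexh` of `stub_kernelRankOneHighExh`. [this work] -/
def Exhausts (O : ValuationSubring K) (A : Subalgebra k K) : Prop :=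
  ∀ x : K, x ∈ O → ∃ m : ℕ, x ∈ tower O A m

/-- `O` has rank one (no valuation ring strictly between `O` and `K`): hypothesis `hrk` of the rank-one
stubs. [this work] -/
def RankOne (O : ValuationSubring K) : Prop :=
  ∀ O' : ValuationSubring K, O ≤ O' → O' = O ∨ O' = ⊤

/-- A PARASITE of the tower of `A` along `O`: a valuation ring `W` of `K`, `W ≠ O`, `W ≠ K`,
containing every stage `T_m`. [this work] -/
def Parasite (O : ValuationSubring K) (A : Subalgebra k K) (W : ValuationSubring K) : Prop :=
  W ≠ O ∧ W ≠ ⊤ ∧ ∀ m : ℕ, ∀ s ∈ tower O A m, s ∈ W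

/-- **T1.** Under rank one, a parasite forbids exhaustion: `⋃ T_m = O` would give `O ≤ W`,
so `W ∈ {O, K}`. [this work] -/
theorem not_exhausts_of_parasite (O : ValuationSubring K) (A : Subalgebra k K)
    (hrk : RankOne O) {W : ValuationSubring K} (hW : Parasite O A W) : ¬ Exhausts O A := by
  intro hexh
  obtain ⟨hWO, hWtop, hWT⟩ := hW
  have hOW : O ≤ W := fun x hx => by
    obtain ⟨m, hm⟩ := hexh x hx
    exact hWT m x hm
  rcases hrk W hOW with h | h
  · exact hWO h
  · exact hWtop h

/-- **T2.** Conversely, if some `t ∈ O` lies in no stage, the tower has a parasite: the union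
`U = ⋃ T_(m+1)` of the normal stages is integrally closed in `K`, so some valuation ring `W ⊇ U`
misses `t` (Chevalley); `t ∈ O ∖ W` gives `W ≠ O` and `W ≠ K`. [this work] -/
theorem exists_parasite_of_not_exhausts (O : ValuationSubring K) (A : Subalgebra k K)
    (hk : ∀ c : k, algebraMap k K c ∈ O) (hA : A.FG) (hfr : IsFractionRing ↥A K)
    (hAO : A.toSubring ≤ O.toSubring) (h : ¬ Exhausts O A) :
    ∃ W : ValuationSubring K, Parasite O A W := by
  classical
  haveI := hfr
  simp only [Exhausts, not_forall, not_exists] at h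
  obtain ⟨t, htO, ht⟩ := h
  -- the chain of normal stages `R i = T (i + 1)` and its union `U`
  let R : ℕ → Subring K := fun i => (tower O A (i + 1)).toSubring
  have hmono : Monotone R := monotone_nat_of_le_succ fun i x hx =>
    d2rc_mem_tower_of_le O A (Nat.le_succ (i + 1)) hx
  have hint : ∀ i, IsIntegrallyClosedIn (R i) K := fun i => by
    haveI : IsIntegrallyClosed (R i) := d2rc_isIntegrallyClosed_tower_succ O A hk hA hfr hAO i
    haveI : IsFractionRing (R i) K :=
      isFractionRing_subalgebra_of_le A (tower O A (i + 1))
        (tn_tower_invariant O A hk hA hfr hAO (i + 1)).1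
    exact (isIntegrallyClosed_iff_isIntegrallyClosedIn K).mp ‹_›
  set U : Subring K := ⨆ i, R i with hU
  have hdir : Directed (· ≤ ·) R := hmono.directed_le
  have hmemU : ∀ x, x ∈ U ↔ ∃ i, x ∈ R i := fun x => Subring.mem_iSup_of_directed hdir
  have hRU : ∀ i, R i ≤ U := fun i => le_iSup R i
  -- `U` is integrally closed in `K` (verbatim the argument of `DominatedUnions`)
  haveI hUint : IsIntegrallyClosedIn U K := by
    rw [Subring.isIntegrallyClosedIn_iff]
    rintro x ⟨p, hpm, hpx⟩
    have hcoef : ∀ n, ∃ i, ((p.coeff n : U) : K) ∈ R i := fun n => (hmemU _).mp (p.coeff n).2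
    choose ι hι using hcoef
    set i : ℕ := p.support.sup ι with hi
    have hιi : ∀ n ∈ p.support, ((p.coeff n : U) : K) ∈ R i := fun n hn =>
      hmono (Finset.le_sup hn) (hι n)
    set φ : R i →+* U := Subring.inclusion (hRU i) with hφ
    have hlifts : p ∈ Polynomial.lifts φ := by
      rw [lifts_iff_coeff_lifts]
      intro n
      by_cases hn : n ∈ p.support
      · exact ⟨⟨(p.coeff n : K), hιi n hn⟩, Subtype.ext rfl⟩
      · rw [notMem_support_iff.mp hn]
        exact ⟨0, map_zero φ⟩
    obtain ⟨q, hqp, -, hqm⟩ := lifts_and_natDegree_eq_and_monic hlifts hpm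
    haveI := hint i
    have hqx : aeval x q = 0 := by
      rw [aeval_def, ← hpx, ← hqp, eval₂_map]
      rfl
    have hxint : IsIntegral (R i) x := ⟨q, hqm, hqx⟩
    obtain ⟨y, hy⟩ := IsIntegrallyClosedIn.algebraMap_eq_of_integral hxint
    rw [← hy]
    exact hRU i y.2
  have htU : t ∉ U := fun h => by
    obtain ⟨i, hi⟩ := (hmemU _).mp h
    exact ht (i + 1) hi
  obtain ⟨W, hUW, htW⟩ := Subring.exists_le_valuationSubring_of_isIntegrallyClosedIn htU
  refine ⟨W, fun hWO => htW (by rw [hWO]; exact htO), fun hWtop => htW ?_, fun m s hs => ?_⟩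
  · rw [hWtop]; exact ValuationSubring.mem_top _
  · exact hUW (hRU m (d2rc_mem_tower_of_le O A (Nat.le_succ m) hs))

/-- **T2′. EXHAUSTION CRITERION.** For a rank-one `O` (and `A ⊆ O` finitely generated with
`Frac A = K`): the stages exhaust `O` iff the tower has NO parasite — `O` is the only point of the
Zariski–Riemann space of `K/k` (other than `K`) lying over the whole tower. [this work] -/
theorem exhausts_iff_forall_not_parasite (O : ValuationSubring K) (A : Subalgebra k K)
    (hk : ∀ c : k, algebraMap k K c ∈ O) (hA : A.FG) (hfr : IsFractionRing ↥A K)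
    (hAO : A.toSubring ≤ O.toSubring) (hrk : RankOne O) :
    Exhausts O A ↔ ∀ W : ValuationSubring K, ¬ Parasite O A W := by
  constructor
  · exact fun hexh W hW => not_exhausts_of_parasite O A hrk hW hexh
  · intro h
    by_contra hne
    obtain ⟨W, hW⟩ := exists_parasite_of_not_exhausts O A hk hA hfr hAO hne
    exact h W hW

/-! ## Singular threads -/

/-- A SINGULAR THREAD of the tower (ring-theoretic form): local subrings `D_m ⊇ T_m` of `K`,
each dominated by the next, such that every NONZERO element of the centre `ca (T_m)` is a
non-unit of `D_m` for every `m` («the point `D_m` is singular»), some centre is nonzero, and some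
stage element of positive `O`-value is a unit of some `D_m` («the point is not the closed point»).
The intended instance is `D_m = (T_m)_(𝔭_m)` for a `SingularPrimeThread` (`PrimeThreadLocalises`,
proved in part II `…ParasiteLocPrime`). [this work] -/
def SingularThread (O : ValuationSubring K) (A : Subalgebra k K) : Prop :=
  ∃ D : ℕ → Subring K,
    (∀ m, IsLocalRing (D m)) ∧
    (∀ m, SubringDominates (D m) (D (m + 1))) ∧
    (∀ m, ∀ s ∈ tower O A m, s ∈ D m) ∧
    (∀ m, ∀ x ∈ ca (tower O A m), x ≠ 0 → x⁻¹ ∉ D m) ∧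
    (∃ m, ∃ x ∈ ca (tower O A m), x ≠ 0) ∧
    (∃ m, ∃ s ∈ tower O A m, s ≠ 0 ∧ O.valuation s < 1 ∧ s⁻¹ ∈ D m)

/-- **T3.** A singular thread produces a parasite: the union `U = ⋃ D_m` of the dominated
chain is a local ring; a valuation ring `W` dominating `U` (Chevalley, Mathlib
`LocalSubring.exists_le_valuationSubring`) contains every stage, inverts the escaping element `s`
(so `W ≠ O`: `s⁻¹ ∉ O`) and does not invert the nonzero centre element `x` (so `W ≠ K`). [this work] -/
theorem exists_parasite_of_singularThread (O : ValuationSubring K) (A : Subalgebra k K)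
    (hk : ∀ c : k, algebraMap k K c ∈ O) (hAO : A.toSubring ≤ O.toSubring)
    (h : SingularThread O A) : ∃ W : ValuationSubring K, Parasite O A W := by
  classical
  obtain ⟨D, hloc, hdom, hT, hca, ⟨m₁, x, hx, hx0⟩, ⟨m₂, s, hs, hs0, hvs, hsD⟩⟩ := h
  have hmono : Monotone D := monotone_nat_of_le_succ fun i => (hdom i).1
  have hdom' : ∀ i j, i ≤ j → SubringDominates (D i) (D j) := by
    intro i j hij
    induction hij with
    | refl => exact SubringDominates.refl _
    | step _ ih => exact ih.trans (hdom _)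
  set U : Subring K := ⨆ i, D i with hU
  have hdir : Directed (· ≤ ·) D := hmono.directed_le
  have hmemU : ∀ y, y ∈ U ↔ ∃ i, y ∈ D i := fun y => Subring.mem_iSup_of_directed hdir
  have hRU : ∀ i, D i ≤ U := fun i => le_iSup D i
  have hinvU : ∀ i y, y ∈ D i → y⁻¹ ∈ U → y⁻¹ ∈ D i := by
    intro i y hy hyU
    obtain ⟨j, hj⟩ := (hmemU _).mp hyU
    exact (hdom' i (max i j) (le_max_left i j)).2 y hy (hmono (le_max_right i j) hj)
  -- `U` is local (verbatim the argument of `DominatedUnions`)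
  haveI hUloc : IsLocalRing U := by
    refine IsLocalRing.of_nonunits_add ?_
    intro a b ha hb
    rw [mem_nonunits_iff] at ha hb ⊢
    intro hab
    obtain ⟨hab0, habinv⟩ := (isUnit_subring_iff_inv_mem _).mp hab
    obtain ⟨i, hi⟩ := (hmemU _).mp a.2
    obtain ⟨j, hj⟩ := (hmemU _).mp b.2
    set l := max i j
    have hak : (a : K) ∈ D l := hmono (le_max_left i j) hi
    have hbk : (b : K) ∈ D l := hmono (le_max_right i j) hj
    haveI := hloc l
    have habk : IsUnit (⟨(a : K) + b, (D l).add_mem hak hbk⟩ : D l) := by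
      rw [isUnit_subring_iff_inv_mem]
      exact ⟨hab0, hinvU l _ ((D l).add_mem hak hbk) habinv⟩
    have habk' : (⟨(a : K) + b, (D l).add_mem hak hbk⟩ : D l) = ⟨a, hak⟩ + ⟨b, hbk⟩ := rfl
    rw [habk'] at habk
    rcases IsLocalRing.isUnit_or_isUnit_of_isUnit_add habk with hu | hu
    · obtain ⟨h0, hinv⟩ := (isUnit_subring_iff_inv_mem _).mp hu
      exact ha ((isUnit_subring_iff_inv_mem _).mpr ⟨h0, hRU l hinv⟩)
    · obtain ⟨h0, hinv⟩ := (isUnit_subring_iff_inv_mem _).mp hu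
      exact hb ((isUnit_subring_iff_inv_mem _).mpr ⟨h0, hRU l hinv⟩)
  -- Chevalley: a valuation ring dominating the local ring `U`
  obtain ⟨W, hW⟩ := (LocalSubring.mk U).exists_le_valuationSubring
  obtain ⟨hUW, hlocHom⟩ := hW
  refine ⟨W, ?_, ?_, fun m y hy => hUW (hRU m (hT m y hy))⟩
  · -- `W ≠ O`: `s⁻¹ ∈ D m₂ ⊆ W`, but `s⁻¹ ∉ O` since `v(s) < 1`
    intro hWO
    have hsO : s ∈ O := mem_valuationSubring_of_mem_tower O hk hAO m₂ s hs
    have hsiW : s⁻¹ ∈ W := hUW (hRU m₂ hsD)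
    have hsiO : s⁻¹ ∈ O := by rw [← hWO]; exact hsiW
    exact absurd (SyzygyFlattening.valuation_eq_one_of_inv_mem O hsO hsiO hs0) (ne_of_lt hvs)
  · -- `W ≠ K`: `x ∈ ca (T m₁)` is a non-unit of `D m₁`, hence of `U`, hence of `W`
    intro hWtop
    have hxT : x ∈ tower O A m₁ := ca_subset _ hx
    have hxU : x ∈ U := hRU m₁ (hT m₁ x hxT)
    have hxiW : x⁻¹ ∈ W := by rw [hWtop]; exact ValuationSubring.mem_top _
    have hunitW : IsUnit (Subring.inclusion hUW ⟨x, hxU⟩) :=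
      (isUnit_subring_iff_inv_mem _).mpr ⟨hx0, hxiW⟩
    have hunitU : IsUnit (⟨x, hxU⟩ : U) := hlocHom.map_nonunit _ hunitW
    obtain ⟨-, hxiU⟩ := (isUnit_subring_iff_inv_mem _).mp hunitU
    exact hca m₁ x hx hx0 (hinvU m₁ x (hT m₁ x hxT) hxiU)

/-- **T4.** A rank-one tower carrying a singular thread is NOT exhaustive. In particular every
counter-model with a persistent singular curve belongs to the non-exhaustive stubs. [this work] -/
theorem not_exhausts_of_singularThread (O : ValuationSubring K) (A : Subalgebra k K)
    (hk : ∀ c : k, algebraMap k K c ∈ O) (hAO : A.toSubring ≤ O.toSubring) (hrk : RankOne O)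
    (h : SingularThread O A) : ¬ Exhausts O A := by
  obtain ⟨W, hW⟩ := exists_parasite_of_singularThread O A hk hAO h
  exact not_exhausts_of_parasite O A hrk hW

/-- Contrapositive bookkeeping for the Exh stub: exhaustive rank-one towers are THREADLESS. [this work] -/
theorem not_singularThread_of_exhausts (O : ValuationSubring K) (A : Subalgebra k K)
    (hk : ∀ c : k, algebraMap k K c ∈ O) (hAO : A.toSubring ≤ O.toSubring) (hrk : RankOne O)
    (hexh : Exhausts O A) : ¬ SingularThread O A :=
  fun h => not_exhausts_of_singularThread O A hk hAO hrk h hexh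

/-! ## Prime threads and the threadless structure (statements) -/

/-- A SINGULAR PRIME THREAD: primes `𝔭_m ⊆ T_m`, compatible (`𝔭_(m+1) ∩ T_m = 𝔭_m`), each
containing the centre `ca (T_m)` («singular point»), some centre nonzero, and some stage element of
positive `O`-value outside its `𝔭_m` («non-closed point»). Geometrically: a compatible chain of
singular non-closed points — a singular curve never resolved at its generic point. [this work] -/
def SingularPrimeThread (O : ValuationSubring K) (A : Subalgebra k K) : Prop :=
  ∃ P : ∀ m : ℕ, Ideal ↥(tower O A m),
    (∀ m, (P m).IsPrime) ∧
    (∀ (m : ℕ) (x : K) (hx : x ∈ tower O A m) (hx' : x ∈ tower O A (m + 1)),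
        (⟨x, hx'⟩ : ↥(tower O A (m + 1))) ∈ P (m + 1) ↔ (⟨x, hx⟩ : ↥(tower O A m)) ∈ P m) ∧
    (∀ (m : ℕ) (x : K) (hx : x ∈ tower O A m),
        x ∈ ca (tower O A m) → (⟨x, hx⟩ : ↥(tower O A m)) ∈ P m) ∧
    (∃ m, ∃ x ∈ ca (tower O A m), x ≠ 0) ∧
    (∃ (m : ℕ) (s : K) (hs : s ∈ tower O A m),
        O.valuation s < 1 ∧ (⟨s, hs⟩ : ↥(tower O A m)) ∉ P m)

/-- **S1 (proved in part II: `primeThreadLocalises_holds`, `…ParasiteLocPrime`).** The localisations `D_m := (T_m)_(𝔭_m)`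
of a singular prime thread form a singular thread: `a/b ∈ D_m ⊆ D_(m+1)` by compatibility,
units reflect (`a/b` unit in `D_(m+1)` ⟹ `a ∉ 𝔭_(m+1)` ⟹ `a ∉ 𝔭_m`), nonzero `x ∈ ca (T_m) ⊆ 𝔭_m`
is a non-unit, and `s ∉ 𝔭_m` is a unit.  A statement of OURS about the objects above (not a
published fact); kept as a named `Prop` because part I only states it. [this work] -/
def PrimeThreadLocalises : Prop :=
  ∀ (k K : Type) [Field k] [Field K] [Algebra k K] (O : ValuationSubring K) (A : Subalgebra k K),
    SingularPrimeThread O A → SingularThread O A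

/-- EVENTUALLY EXCEPTIONAL SINGULAR LOCI: every element `s` of positive value of a stage `T_m`
becomes nilpotent modulo the centre ideal `ca (T_(m')) · T_(m')` of some later stage — i.e.
`Sing (T_(m')) = V(ca T_(m'))` lies over the closed point of `Spec T_m`: every singular curve of
stage `m` is resolved at its generic point by stage `m'`. [this work] -/
def EventuallyExceptionalSing (O : ValuationSubring K) (A : Subalgebra k K) : Prop :=
  ∀ m : ℕ, ∀ s ∈ tower O A m, O.valuation s < 1 →
    ∃ m' : ℕ, m ≤ m' ∧ ∃ N : ℕ,
      s ^ (N + 1) ∈ Submodule.span ↥(tower O A m') (ca (tower O A m'))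

/-- **S2 (proved in part III: `threadlessOfExhausts_holds`, `…ParasiteThreadless` — prime avoidance in `⋃ T_m` + radical
persistence give a `SingularPrimeThread` from any element violating `EventuallyExceptionalSing`; then S1,
T3, T1).** An exhaustive rank-one tower with radical persistence and a nonzero centre has
eventually exceptional singular loci. This is the FREE structural hypothesis the Exh stub
(`stub_kernelRankOneHighExh`) may assume.  A statement of OURS (not a published fact); kept as a named
`Prop` because part I only states it. [this work] -/
def ThreadlessOfExhausts : Prop :=
  ∀ (k K : Type) [Field k] [Field K] [Algebra k K] (O : ValuationSubring K) (A : Subalgebra k K),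
    (∀ c : k, algebraMap k K c ∈ O) → A.toSubring ≤ O.toSubring →
    (∀ m : ℕ, ∀ x ∈ ca (tower O A m), ∃ N : ℕ, 1 ≤ N ∧ x ^ N ∈ ca (tower O A (m + 1))) →
    RankOne O → Exhausts O A → (∃ m, ∃ x ∈ ca (tower O A m), x ≠ 0) →
    EventuallyExceptionalSing O A

/-- **L1 (a step of S2): radical persistence pushes singular primes DOWN the tower** —
if `ca (T_m) ⊆ √ca (T_(m+1))` elementwise and a prime `𝔮` of `T_(m+1)` contains `ca (T_(m+1))`,
then `𝔮 ∩ T_m` contains `ca (T_m)`. [this work] -/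
theorem ca_subset_comap_of_persistenceRadical (O : ValuationSubring K) (A : Subalgebra k K) (m : ℕ)
    (hPR : ∀ x ∈ ca (tower O A m), ∃ N : ℕ, 1 ≤ N ∧ x ^ N ∈ ca (tower O A (m + 1)))
    (Q : Ideal ↥(tower O A (m + 1))) (hQ : Q.IsPrime)
    (hcaQ : ∀ (y : K) (hy : y ∈ tower O A (m + 1)),
      y ∈ ca (tower O A (m + 1)) → (⟨y, hy⟩ : ↥(tower O A (m + 1))) ∈ Q)
    (x : K) (hx : x ∈ ca (tower O A m)) (hx' : x ∈ tower O A (m + 1)) :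
    (⟨x, hx'⟩ : ↥(tower O A (m + 1))) ∈ Q := by
  obtain ⟨N, -, hN⟩ := hPR x hx
  have hxN : x ^ N ∈ tower O A (m + 1) := ca_subset _ hN
  have hmem : (⟨x, hx'⟩ : ↥(tower O A (m + 1))) ^ N ∈ Q := by
    have : (⟨x, hx'⟩ : ↥(tower O A (m + 1))) ^ N = ⟨x ^ N, hxN⟩ := Subtype.ext rfl
    rw [this]
    exact hcaQ (x ^ N) hxN hN
  exact hQ.mem_of_pow_mem N hmem

/-- **C1 (over the literal hypotheses of `stub_kernelRankOneHighExh`).** In the exhaustive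
rank-one kernel regime the tower is parasite-free and threadless — a free structural hypothesis for
the Exh stub, and the reason no cylinder / Nash-loop counter-model can bear on it. [this work] -/
theorem stubExh_parasiteFree_threadless (O : ValuationSubring K) (A : Subalgebra k K)
    (hk : ∀ c : k, algebraMap k K c ∈ O) (hAO : A.toSubring ≤ O.toSubring)
    (hrk : ∀ O' : ValuationSubring K, O ≤ O' → O' = O ∨ O' = ⊤)
    (hexh : ∀ x : K, x ∈ O → ∃ m : ℕ, x ∈ tower O A m) :
    (∀ W : ValuationSubring K, ¬ Parasite O A W) ∧ ¬ SingularThread O A :=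
  ⟨fun _ hW => not_exhausts_of_parasite O A hrk hW hexh,
    not_singularThread_of_exhausts O A hk hAO hrk hexh⟩

/-! ## Objects used in parts II/III: the explicit localisation of a stage at a prime, and the
singular radical of a stage (defined here so that parts II/III are pure-proof files) -/

/-- Nonzero-ness of elements outside a proper ideal. [this work] -/
theorem ne_zero_of_not_mem_ideal (T : Subalgebra k K) (P : Ideal ↥T) {b : K} (hb : b ∈ T)
    (hbP : (⟨b, hb⟩ : ↥T) ∉ P) : b ≠ 0 := by
  rintro rfl
  exact hbP (by
    have : (⟨(0 : K), hb⟩ : ↥T) = 0 := Subtype.ext rfl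
    rw [this]; exact P.zero_mem)

/-- `locPrime T P` — the fractions `a * b⁻¹`, `a, b ∈ T`, `b ∉ P`, for a prime `P` of `T`:
the local ring `T_P` realised inside `K`. [this work] -/
def locPrime (T : Subalgebra k K) (P : Ideal ↥T) (hP : P.IsPrime) : Subring K where
  carrier := {y | ∃ (a : K) (b : K) (ha : a ∈ T) (hb : b ∈ T), (⟨b, hb⟩ : ↥T) ∉ P ∧ y = a * b⁻¹}
  mul_mem' := by
    rintro y z ⟨a, b, ha, hb, hbP, rfl⟩ ⟨c, d, hc, hd, hdP, rfl⟩
    refine ⟨a * c, b * d, T.mul_mem ha hc, T.mul_mem hb hd, ?_, ?_⟩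
    · intro h
      have h' : (⟨b, hb⟩ : ↥T) * ⟨d, hd⟩ ∈ P := h
      rcases hP.mem_or_mem h' with h1 | h1
      · exact hbP h1
      · exact hdP h1
    · rw [mul_inv]; ring
  one_mem' := ⟨1, 1, T.one_mem, T.one_mem, fun h => hP.ne_top (P.eq_top_of_isUnit_mem h isUnit_one),
    by simp⟩
  add_mem' := by
    rintro y z ⟨a, b, ha, hb, hbP, rfl⟩ ⟨c, d, hc, hd, hdP, rfl⟩
    have hb0 : b ≠ 0 := ne_zero_of_not_mem_ideal T P hb hbP
    have hd0 : d ≠ 0 := ne_zero_of_not_mem_ideal T P hd hdP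
    refine ⟨a * d + c * b, b * d, T.add_mem (T.mul_mem ha hd) (T.mul_mem hc hb), T.mul_mem hb hd,
      ?_, ?_⟩
    · intro h
      have h' : (⟨b, hb⟩ : ↥T) * ⟨d, hd⟩ ∈ P := h
      rcases hP.mem_or_mem h' with h1 | h1
      · exact hbP h1
      · exact hdP h1
    · field_simp
  zero_mem' := ⟨0, 1, T.zero_mem, T.one_mem,
    fun h => hP.ne_top (P.eq_top_of_isUnit_mem h isUnit_one), by simp⟩
  neg_mem' := by
    rintro y ⟨a, b, ha, hb, hbP, rfl⟩
    exact ⟨-a, b, T.neg_mem ha, hb, hbP, by ring⟩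

/-- Membership in `locPrime T P hP`, definitionally. [this work] -/
theorem mem_locPrime_iff (T : Subalgebra k K) (P : Ideal ↥T) (hP : P.IsPrime) {y : K} :
    y ∈ locPrime T P hP ↔
      ∃ (a : K) (b : K) (_ : a ∈ T) (hb : b ∈ T), (⟨b, hb⟩ : ↥T) ∉ P ∧ y = a * b⁻¹ :=
  Iff.rfl

/-- «Numerator in `P`»: `y = a * b⁻¹` with `a ∈ P`, `b ∉ P` — the non-units of the localisation. [this work] -/
def NumInP (T : Subalgebra k K) (P : Ideal ↥T) (y : K) : Prop :=
  ∃ (a : K) (b : K) (ha : a ∈ T) (hb : b ∈ T), (⟨b, hb⟩ : ↥T) ∉ P ∧ (⟨a, ha⟩ : ↥T) ∈ P ∧ y = a * b⁻¹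

/-- The centre ideal `ca(T_m)·T_m` of stage `m`, as an ideal of the stage. [this work] -/
def caIdeal (O : ValuationSubring K) (A : Subalgebra k K) (m : ℕ) : Ideal ↥(tower O A m) :=
  Ideal.span {c : ↥(tower O A m) | (c : K) ∈ ca (tower O A m)}

/-- The SINGULAR RADICAL `√(ca(T_m)·T_m)` — the ideal of the singular locus of stage `m`. [this work] -/
def singRad (O : ValuationSubring K) (A : Subalgebra k K) (m : ℕ) : Ideal ↥(tower O A m) :=
  (caIdeal O A m).radical

end Summit.ResolutionOfSingularities.ResolutionOfSingularities.Theorems.NoZeno.SandwichCluster.Parasite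

end
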